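import Summits.QuantumFields.YangMills.Theorems.BalabanUVNodesN24N12BillH12AtWitnessOfJunctionRowsRunGuardedAx
import Summits.QuantumFields.YangMills.Theorems.BalabanUVNodesN24N09AxDoorNumericRows7PaidAtGaussPinThm1CCMWZBAx

/-!
# BalabanUVNodes ∕ N24 ⟵ N12 → K1ᴬ — N12's MEMORY-GUARDED BILL AT THE LINE-2′ WITNESS MEMBER UNDER A RADIUS CEILING (v11.4 RUN-KEYED; edition L2 of `…N24N12BillH12AtWitnessOfJunctionRowsRunGuardedAx`, the adapter over dag-n12-d's G4ʳ ✓p837975; the v11.3 siblings ✓p837139∕✓p837145 are history):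
# the engine's socket ceiling on the member's radius `a₀ = εreg = εbg` PAYS MORE of G4's displayed rows at the pin — LOCATED-N12-RADIUS (dag-n24-c g27): of G4's five εreg-smallness rows exactly ONE
# (`hα3`) is paid by the ENGINE's ceiling `a₀ ≤ 1∕(109824·L²)` (edition L2, = (W)∕E6's prefix letter `ha₀ρ`; EXACTLY, `143·16²·a₀L² = 36 608·a₀L² ≤ 36 608∕109 824 = 1∕3` — the same arithmetic that
# pays N09's `hε3` in ✓p816166), the other four (`hα2`, `haN`, `hα3h`, `hα2h`) want `a₀ = O(L⁻⁴)` resp. HALF the L2 ceiling and are ALL paid by `a₀ ≤ 1∕(219648·L⁴)` (edition L4 — a ceiling the engine's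
# socket call can adopt for free, since the socket returns SOME `0 < a₀ ≤ a` for any `a > 0`; an engine-display matter, on a word)

Cell `pub-ymgap` (HUMAN RULING D-0062), seat `pub-ymgap-dag-n24-c` g27 (R134 N24 [B2 composite] s2; -a hand on K1ᴬ `stmt-QuantumFields-27239` LINE 2′, v11.3 4d5a20924a86ea9d); `--kind proof --supports stmt-QuantumFields-27239
--as helper`, count-neutral.  PARENT: E8″ `…N24N12BillH12AtWitnessOfJunctionRowsRunGuardedAx` (this seat, v11.4) — imported and APPLIED ONCE; this file only adds the ceiling letter to the prefix and pays, at the pin, the rows the ceiling decides: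
edition L2 (`ha₀ρ : a₀ ≤ 1∕(109824·L²)`, the engine's own letter): `hα3` + `hM4 : ∀ P, 4L ≤ M₁` (from the head's floor row `(d+14)·L ≤ M₁`) + `hdiv` (IS the head's `hdiv₀` at the member: F4∕G4's
`ν₀`-row and `Θ.ν`-row coincide once `ν₀ := θN.ν`) — three rows; edition L4 (`ha₀ρ : a₀ ≤ 1∕(219648·L⁴)`): those three + `hα2 : 2εregL² ≤ 2δ₂∕(8L)²` (⟸ `128·a₀L⁴ ≤ 2∕3`), `haN : 9L²·2εregL² < δ₂ = 1∕3`
(⟸ `18·a₀L⁴ < 1∕3`), `hα3h : 36 608·2L²εreg ≤ 1∕3` (⟸ `a₀L² ≤ 1∕219 648`), `hα2h : 2·2L²εreg ≤ 2δ₂∕(8L)²` (⟸ `256·a₀L⁴ ≤ 2∕3`) — seven rows (`δ₂ = δ_{SU(2)} = 1∕3`, `AvgActionDefect.deltaSU_fin_two`; `d = 4`;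
`8 ≤ L`, `eight_le_L_stage3OfFamily`).  Everything else of E8 is displayed VERBATIM (the β-SIGN leaf, the window letters, `a₀ < a₁₅`, the instance ∕ guard ∕ STEP-token ∕ live-mass ∕ term-pin ∕ ℍ-leaf ∕
(J0′)-head rows); CONCLUSION = the v11.4 engine's RUN-KEYED MEMORY-GUARDED `h12F` body at `θN` (`…N24K1AxV114Line2VWN09T7AxAtCofinalBetaSocketGaussPinPrintedZBY`).

LOCATED-N12-RADIUS (first-hand, arithmetic over the displayed rows; d = 4, δ₂ = 1∕3): at the member `εreg = a₀`, G4's rows read `hα3 ⟺ a₀ ≤ 1∕(109 824·L²)` · `hα3h ⟺ a₀ ≤ 1∕(219 648·L²)` ·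
`hα2 ⟺ a₀ ≤ 1∕(192·L⁴)` · `hα2h ⟺ a₀ ≤ 1∕(384·L⁴)` · `haN ⟺ a₀ < 1∕(54·L⁴)`; the engine's ceiling `1∕(109 824·L²)` (chosen in the «N09T-Ax» edition to pay N09's `hε3` exactly) meets only the
first; ONE ceiling `1∕(219 648·L⁴)` meets all five and keeps N09's seven numeric rows paid (they need `a₀ ≤ 1∕(109 824·L²)`, weaker for `L ≥ 1`).  So the h12F payer at the engine's member needs
either the lower ceiling in the engine's socket call (`a := min ā (1∕(219648·L⁴))` — display change, №-line matter) or the four rows from elsewhere; nothing else of N12's bill reads the radius ceiling.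

HONEST FRAMING.  Kernel bookkeeping (one application of E8 + 3 ∕ 7 arithmetic payments); nothing of Bałaban asserted; `h12F` NOT paid; N12 NOT discharged; `stub_nodes13PWSVW` NOT closed; K0ᴬ ∕ K1ᴬ ∕
K3ᴬ OPEN (K1ᴬ 0∕6 (v11.4)); counts unmoved (discharged 8∕27 · K 1∕4); one finite 𝕋⁴ programme at fixed `ε = L^{-K}` — NOT continuum ∕ ℝ⁴ ∕ OS; NOT the Yang–Mills mass gap (Clay).  THEOREMS ONLY
(0 `def`, 0 `instance`, 0 `sorry`, standard axioms); generator `gen_e9r.py` (MODE=L2∕L4) over E8″'s bytes.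
Sources (bookkeeping only): [Balaban1989LargeFieldI] (0.2)–(0.6) p.176, Prop. 1 (1.78) p.194, (1.99)–(1.102) pp.200–201; [Balaban1987RG1] (0.4)–(0.9) pp.252–253 (`δ_SU(2)`), (0.20)–(0.21) p.256,
Thm 1 p.259, (2.9) p.266; [Balaban1988Convergent] (2.4)–(2.8) pp.255–256, (3.22)–(3.25) pp.269–270.
-/

noncomputable section

open scoped BigOperators ENNReal
open MeasureTheory
open scoped Matrix.Norms.L2Operator
open MeasureTheory Set Finset Metric Filter
open scoped Matrix.Norms.L2Operator BigOperators Matrix RealInnerProductSpace Real InnerProductSpace Topology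

namespace Summit.QuantumFields.YangMills.BalabanUVNodes.N24N12BillH12AtWitnessOfJunctionRowsRunGuardedCeilingAx

open Summit.QuantumFields.YangMills.BalabanUVNodes.N24N12BillH12AtWitnessOfJunctionRowsRunGuardedAx (N24_h12F_at_theta13OfThm1CCMWZBAx_of_junctionRowsRunGuarded)
open Summit.QuantumFields.YangMills.Theorems (AvgActionDefect.deltaSU_fin_two)
open Summit.QuantumFields.YangMills.BalabanUVNodes.N12BillH12ForStub1VWK1AxV11OfJunctionRowsRunGuarded (h12_bill_at_liveRepin₁₃Ax_of_junctionRowsRunGuarded)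
open Summit.QuantumFields.YangMills.BalabanUVNodes.N12AtTheta13OfThm1CCMWSmallWindow (smallnessFor_half_two_one gamma_mul_p0Profile_le_tenth)
open Literature.MathematicalPhysics.QuantumFieldTheory.Balaban1983to89.B15DeterminingSetsB
open Literature.MathematicalPhysics.QuantumFieldTheory.Balaban1983to89
open Literature.MathematicalPhysics.QuantumFieldTheory.Balaban1983to89.T4Continuum (T4Family LStep Letter walk walkEnd netDisp holAt)
open Literature.MathematicalPhysics.QuantumFieldTheory.Balaban1983to89.DagBinding
open Literature.MathematicalPhysics.QuantumFieldTheory.Balaban1983to89.Node00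
open FlowStep (prefixOf BetaLowerH BetaUpperH)
open B15Claim189Assembly (new189 chiPP dom half)
open B15 (Prop1Printed Ineq180)
open B15.BasicStep (Claim189)
open B8Eq17ClassAkV1 (plaqsOf)
open B14.Eq216Concrete (inputs feeds)
open GaugeGroup (dist1)
open GaugeField (plaqHol gaugeAct)
open B15RPrime1100OfRep (rPrimeDataOfSel)
open T4CubeChartGnomonic (SU2)
open B15Prop1ChartSU2 (su2Chart)
open B15Prop1SliceCoordinates (GaugeSlice ιA)
open T4AxialGaugeSmallField (castSite boxPlaqs boxBonds)
open B6BondElimination (unitVec)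
open B6TreeGaugePoincare (curl)
open B16Eq18Proof (box)
open B15Extension193 (extend)
open B15ShellGauge193 (shellGauge)
open B15Sect1Instances (fun177stdB)
open B14.Eq213DetSet (Bj maxDomT)
open B14.Eq213MaximalDomains (side)
open B14.Eq22Determines (blockIter IsBlockUnion)
open Literature.MathematicalPhysics.QuantumFieldTheory.BalabanImbrieJaffe1984to88.BIJ85Eq453GaugeField (qsstarGIter0)
open B16Sect1Backgrounds (expMul toMS)
open B15DeterminingSets (pts DetBackground genSet IsMinimizer MSField avgFamily bondsOf DetSet embIter AgreeOn)
open B5Eq118OneStroke (iterBlockOf)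
open Literature.MathematicalPhysics.QuantumFieldTheory.Balaban1983to89.Node00 (coeField constrEnumB)
open B15Eq112TorusCover (lift)
open ExpMeanLog (deltaSU)
open B15Prop1Carrier (lfVarOn InstOn InstOn.std InstOn.stdB plaqsInside)
open Summit.QuantumFields.YangMills.BalabanUVNodes.N12AtRecord13Prop1KnitThm1WindowDirectDatumScaleLettersDischargedAtLengthOfRegNameAndStepOfRecord (thm1LetterT_atLength_pTop_of_variationalThm1RegSepCoP7MGB_lamTop)
open B15Claim189Assembly (Setting189)
open B14DomainGeom (Pt)
open B15.PrelimIntegrations (Ineq191 Ineq195)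
open B15Chi124DetSets (E124)
open B15Claim189PrintedConditions (omegaOfChain)
open B15Claim189PinsOfHistory (N0OfRecord₁₃)
open B15Claim189LambdaPin (enlD)
open Summit.QuantumFields.YangMills.BalabanUVNodes.N12MinimiserFamilyKnitRowThm1LettersAtLengthOnZOfRecordBR (exists_R_hMinRow_of_thm1LettersAtLength_alongOrbit_onZ_ofRecord)
open Summit.QuantumFields.YangMills.BalabanUVNodes.N12Thm1LettersAtLengthOfK0GridGB (thm1LetterT_atLength_of_variationalThm1RegSepCoP7MGB)
open B15Prop1NumericsThresholds (plaqSmallOn_of_le)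
open B15Prop1MinimiserClassAtDatumScaleAtLengthB (isMinimizerB_withEps_base_of_thm1AtLength isMinimizerB_withEps_of_norm_lt_atLength lamBondsSeq_congr)
open Summit.QuantumFields.YangMills.BalabanUVNodes.N12DirectChartPackageOfClassRowL1FamilyB (exists_hWD_chartHalf_of_class_uniform_rowl1_family)
open Summit.QuantumFields.YangMills.BalabanUVNodes.N12Prop1DirectOfClassOnlyRowL1UniformBLam (exists_rowPreimageProxiesLetter_family_uniformB_lamBondsSeq)
open Summit.QuantumFields.YangMills.BalabanUVNodes.N12Prop1DirectOfClassOnlyB (exists_curvatureLetters_family)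
open Summit.QuantumFields.YangMills.BalabanUVNodes.N12MinimiserFamilyKnitRowThm1Letters (boxRow3_of_boxRow5)
open T4AdjointCovarianceUnitary (lieSU)
open B15Prop1GradientFromNearValueAtCoPRecord (far_letter_of_box)
open B15Prop1AnalyticExtClause (cplxVec anExt)
open B15Prop1ChartCalculusSU2 (E3)
open B15Sect1Instances (lamDatumP)
open B11Thm1ExistsUniqueTokensGB (VariationalThm1EUSepCoP7MGB VariationalThm1EUStepCoP7MGB)
open B11Thm1ExistsUniqueInductionG (truncSeq)
open Summit.QuantumFields.YangMills.BalabanUVNodes.N12EUStepTokensAtRealisedDataLam (variationalThm1EUSepCoP7MGB_realised_of_step_of_reg_lamTop)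
open Summit.QuantumFields.YangMills.BalabanUVNodes.N12Thm1LettersAtLengthOfK0GridGB (blockSat_torusClassSeq)
open Summit.QuantumFields.YangMills.BalabanUVNodes.N12Thm1LettersAtLengthOfK0GridGB (thm1LetterEU_atLength_of_variationalThm1EUSepCoP7MGB)
open B15Claim189PinsOfHistory (N0OfRecord₁₃Chi N0OfRecord₁₃Ax)
open B14FlowStep (SmallnessFor)

section
variable {F : T4Family}

/-- **★★★ N12's MEMORY-GUARDED BILL AT THE LINE-2′ MEMBER UNDER THE ENGINE's RADIUS CEILING `a₀ ≤ 1∕(109824·L²)`** (v11.4 run-keyed; edition L2 of `…RunGuardedAx`): E8's statement with the engine's prefix letter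
`ha₀ρ` added and THREE more rows PAID at the pin — `hα3 : 143·((d+4)²∕4)²·(εreg·L²) ≤ 1∕3` (EXACTLY: `36 608·a₀L² ≤ 1∕3`), `hM4 : 4L ≤ M₁` (head's floor row), `hdiv` (= `hdiv₀` at the member);
every other row of E8 displayed verbatim; conclusion = the v11.4 engine's `h12F` body at `θN`.  Nothing of Bałaban asserted; `h12F` NOT paid; N12 NOT discharged.
[cite: Balaban1989LargeFieldI, (0.2)–(0.6) p.176, Prop. 1 (1.78) p.194, (1.99)–(1.102) pp.200–201; Balaban1987RG1, (0.4)–(0.9) pp.252–253, (0.21) p.256, Thm 1 p.259, (2.9) p.266; Balaban1988Convergent, (2.4)–(2.8) pp.255–256, (3.22) p.269] -/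
theorem N24_h12F_at_theta13OfThm1CCMWZBAx_of_junctionRowsRunGuarded_ceilingL2
    -- THE MEMBER OF THE LINE-2′ WITNESS FAMILY under its ABSTRACT NAME `θN` (the engine's `h12F` prefix letters this file reads; the pin `hθ` is consumed `_ rfl` by the payer)
    {j : ℕ} {γ ε₀ ε₂₉ B₃ B₃' a₀ a₁ : ℝ} {Efl logz : B12.RunParams → ℕ → ℝ}
    (θN : Stage13Params F 2) (hθ : θN = theta13OfThm1CCMWZBAx F 2 j γ a₀ ε₀ ε₂₉ B₃ B₃' a₀ a₁ Efl logz)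
    (hγh : γ ≤ 1 / 2) (hB : 0 ≤ B₃) (hB' : 0 ≤ B₃') (ha₀ : 0 < a₀) (ha₁ : 0 < a₁) (ha₀ρ : a₀ ≤ 1 / (109824 * (F.L : ℝ) ^ 2))
    {β' : ℝ} (hbox' : BetaUpperH β' γ (betaOfRecord₁₃Ax F 2 θN)) (hβ' : β' * γ ^ 2 ≤ 3 / 4)
    -- F4's INSTANCE ∕ GUARD ∕ STEP-TOKEN ROWS, VERBATIM (the bill's [15] constants renamed `B₁₅ a₁₅ a₁₅′`; `ν₀ := θN.ν`)
    (hd3 : ∀ P : B12.RunParams, 3 ≤ (F.P P.K).d)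
    (h0 : ∀ P : B12.RunParams, 0 < (F.P P.K).d)
    (ι : B12.RunParams → Type)
    {B₁₅ a₁₅ a₁₅' : ℝ}
    (Z Λ : ∀ P : B12.RunParams, ι P → Set (Site (F.P P.K) 0))
    (k : ∀ P : B12.RunParams, ι P → ℕ)
    (M : ∀ P : B12.RunParams, ι P → ℝ)
    (hk0 : ∀ (P : B12.RunParams) (i : ι P), 0 < k P i)
    (hk1 : ∀ (P : B12.RunParams) (i : ι P), k P i + 1 ≤ (F.P P.K).m + (F.P P.K).K)
    (T : ∀ (P : B12.RunParams) (i : ι P), Finset (PBond (F.P P.K) (k P i)))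
    (lo hi : ∀ P : B12.RunParams, ι P → Fin (F.P P.K).d → ℤ)
    (n : ∀ P : B12.RunParams, ι P → ℕ)
    (hn : ∀ (P : B12.RunParams) (i : ι P) κ, hi P i κ ≤ lo P i κ + n P i)
    (hN : ∀ (P : B12.RunParams) (i : ι P), n P i + 2 < (F.P P.K).sitesPerDir (k P i))
    (hbox : ∀ (P : B12.RunParams) (i : ι P), pts (k P i) (Λ P i) = (castSite '' Set.Icc (lo P i) (hi P i) : Set (Site (F.P P.K) (k P i))))
    (hZ : ∀ (P : B12.RunParams) (i : ι P), (boxPlaqs (lo P i - 1) (hi P i + 1) : Set (Plaq (F.P P.K) (k P i))) ⊆ plaqsInside (pts (k P i) (Z P i)))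
    (hTG0 : ∀ (P : B12.RunParams) (i : ι P), T P i = (box (fun κ => (hi P i κ - lo P i κ + 1).toNat) (lo P i)).image fun x =>
      (⟨castSite (x - unitVec ⟨0, h0 P⟩), ⟨0, h0 P⟩⟩ : PBond (F.P P.K) (k P i)))
    (hN5 : ∀ (P : B12.RunParams) (i : ι P) κ, ((hi P i κ - lo P i κ + 1).toNat : ℤ) + 5 < (F.P P.K).sitesPerDir (k P i))
    (Kb : ∀ P : B12.RunParams, ι P → ℕ)
    (hK1 : ∀ (P : B12.RunParams) (i : ι P), 1 ≤ Kb P i)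
    (hKn : ∀ (P : B12.RunParams) (i : ι P) κ, (hi P i κ - lo P i κ + 1).toNat ≤ Kb P i)
    (ext : ∀ (P : B12.RunParams) (i : ι P), GaugeField (F.P P.K) (k P i) SU2 → GaugeField (F.P P.K) (k P i) SU2)
    (hext : ∀ (P : B12.RunParams) (i : ι P) Vk, ext P i Vk = extend (pts (k P i) (Λ P i)) (shellGauge Vk (lo P i) (hi P i)) Vk)
    (hlohi : ∀ (P : B12.RunParams) (i : ι P), lo P i ≤ hi P i)
    (LO HI : ∀ P : B12.RunParams, ι P → Fin (F.P P.K).d → ℤ)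
    (hLO : ∀ (P : B12.RunParams) (i : ι P), LO P i ≤ lo P i - 1)
    (hHI : ∀ (P : B12.RunParams) (i : ι P), hi P i + 1 ≤ HI P i)
    (n' : ∀ P : B12.RunParams, ι P → ℕ)
    (hn' : ∀ (P : B12.RunParams) (i : ι P) κ, HI P i κ ≤ LO P i κ + n' P i)
    (hn'N : ∀ (P : B12.RunParams) (i : ι P), n' P i < (F.P P.K).sitesPerDir (k P i))
    (hR' : ∀ (P : B12.RunParams) (i : ι P), (boxPlaqs (LO P i) (HI P i) : Set (Plaq (F.P P.K) (k P i))) ⊆ plaqsInside (pts (k P i) (Z P i)))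
    {γ₈ bx : B12.RunParams → ℝ}
    (hγ : ∀ P : B12.RunParams, 0 < γ₈ P)
    (hbx : ∀ P : B12.RunParams, 0 ≤ bx P)
    (hbxM : ∀ (P : B12.RunParams) (i : ι P), 12 * ((F.P P.K).d : ℝ) * ((n P i : ℝ) + 2) ^ 2 ≤ bx P * (M P i) ^ 2)
    (hM : ∀ (P : B12.RunParams) (i : ι P), 1 ≤ (M P i))
    (W : ∀ P : B12.RunParams, ι P → Finset (Plaq (F.P P.K) 0))
    (hWbox : ∀ (P : B12.RunParams) (i : ι P), ∀ q : Plaq (F.P P.K) 0, q.src ∈ ((box (fun κ => (F.P P.K).L ^ (k P i) * ((hi P i κ - lo P i κ + 1).toNat + 3 + 1) - 1) (fun κ => ((F.P P.K).L : ℤ) ^ (k P i) * (lo P i κ - 2))).image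
        (fun z => (castSite z : Site (F.P P.K) 0))) → q ∈ W P i)
    (c : ∀ P : B12.RunParams, ι P → ℕ)
    (hkc : ∀ (P : B12.RunParams) (i : ι P), k P i + c P i ≤ (F.P P.K).m + (F.P P.K).K)
    (hc : ∀ (P : B12.RunParams) (i : ι P), 4 * (F.P P.K).d + (3 * ((F.P P.K).d * (((F.P P.K).L - 1) / 2)) + 5) + 3 < 2 * (F.P P.K).L ^ c P i)
    (X : ∀ P : B12.RunParams, ι P → Set (Site (F.P P.K) 0))
    (D₀ : ∀ P : B12.RunParams, ι P → ℕ)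
    (hBox : ∀ (P : B12.RunParams) (i : ι P), ∀ x ∈ X P i, ∀ w : List (Letter (F.P P.K).d),
      w.length ≤ (∑ i' ∈ Finset.range (k P i + 1), ((F.P P.K).d * (((F.P P.K).L ^ i' - 1) / 2) + 1)) + (3 * ((F.P P.K).d * (((F.P P.K).L - 1) / 2)) + 5) * (F.P P.K).L ^ k P i + (F.P P.K).L ^ k P i →
      ∀ μ : Fin (F.P P.K).d, (⟨B14.Eq22Determines.blockIter (k P i) (walkEnd x w), μ⟩ : PBond (F.P P.K) (k P i)) ∈ (boxBonds (LO P i) (HI P i) : Set (PBond (F.P P.K) (k P i))))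
    (hWX : ∀ (P : B12.RunParams) (i : ι P), ∀ p ∈ W P i, p.src ∈ X P i ∧ p.src.shift p.μ ∈ X P i ∧ p.src.shift p.ν ∈ X P i ∧ (p.src.shift p.μ).shift p.ν ∈ X P i ∧ (p.src.shift p.ν).shift p.μ ∈ X P i)
    (hfeedsX : ∀ (P : B12.RunParams) (i : ι P) (ν' : Fin (F.P P.K).d), ∀ z ∈ box (fun κ => (hi P i κ - lo P i κ + 1).toNat + 3) (fun κ => lo P i κ - 2), ∀ b₀ : PBond (F.P P.K) 0,
      (b₀ ∈ feeds (k P i) (⟨(castSite z : Site (F.P P.K) (k P i)), ⟨0, h0 P⟩⟩ : PBond (F.P P.K) (k P i)) ∨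
        b₀ ∈ feeds (k P i) (⟨((castSite z : Site (F.P P.K) (k P i))).shift ⟨0, h0 P⟩, ν'⟩ : PBond (F.P P.K) (k P i)) ∨
        b₀ ∈ feeds (k P i) (⟨((castSite z : Site (F.P P.K) (k P i))).shift ν', ⟨0, h0 P⟩⟩ : PBond (F.P P.K) (k P i)) ∨
        b₀ ∈ feeds (k P i) (⟨(castSite z : Site (F.P P.K) (k P i)), ν'⟩ : PBond (F.P P.K) (k P i))) → b₀.src ∈ X P i ∧ b₀.tgt ∈ X P i)
    {cE cA : B12.RunParams → ℝ}
    (hcE0 : ∀ P : B12.RunParams, 0 ≤ cE P)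
    (hcE : ∀ (P : B12.RunParams) (i : ι P), 12 * ((F.P P.K).d : ℝ) * ((n P i : ℝ) + 2) ^ 2 ≤ cE P)
    (hγle : ∀ (P : B12.RunParams) (i : ι P), γ₈ P / (M P i) ^ 5 ≤ 1 / 2 / (2 * (3 * (Kb P i : ℝ) ^ 2 + 2 * (Kb P i : ℝ) ^ 4)))
    (hZblk : ∀ (P : B12.RunParams) (i : ι P), IsBlockUnion (k P i) (Z P i))
    (hB₃ : 0 < B₁₅)
    -- [15] THEOREM 1 (8) = (R), GUARD-GENERIC NAMED FACT in K0⁷'s house AT PRINT's CURRENCY `(lamDatum F, dataSmall7LamTopOf F 2)` (`Adm : StepGuard F`; at `Adm := A‴(c,c₀,c₁)` and the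
    -- stub's constants = K0⁷'s V23 stub 1ᴮ `K0V23Defs.Prop8StepCoPGridGBAt` through k0-s1-w1's 53′; INHABITED there by `K0Stub1BHolds` ∕ this seat's 112 — at GENERIC constants: displayed)
    (Adm : Node00.StepGuard F) (h15 : VariationalThm1RegSepCoP7MGB F 2 Adm (lamDatum F) (dataSmall7LamTopOf F 2) B₁₅ a₁₅ a₁₅')
    -- THE GUARD's TWO STRUCTURAL ROWS print's induction (11)–(14) reads: the standing range and stability under truncation (`truncSeq`); at `A‴` both are arithmetic (dag-n12-c ✓p782972)
    (hAdmK : ∀ ν M' g K k' (s : SeqOfRecord F ν M' g K k'), Adm ν M' g K k' s → k' ≤ (F.P K).m + (F.P K).K)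
    (hAdmTr : ∀ ν M' g K k' (s : SeqOfRecord F ν M' g K (k' + 1)), 0 < k' → Adm ν M' g K (k' + 1) s → Adm ν M' g K k' (truncSeq s))
    -- THE (J0′) HEAD's SKELETON ROWS AT εreg-BLIND NUMERICS `θN.ν` (the head of record ✓p740879 is instantiated at `θN.ν`; `θN.ν` is pinned to `θN.ν` off the class threshold below)
    (hdiv₀ : ∀ (P : B12.RunParams) (i : ι P), side (F.P P.K).L θN.ν.M₁ (k P i) ∣ (F.P P.K).sitesPerDir 0)
    (hfloor₀ : ∀ P : B12.RunParams, ((F.P P.K).d + 14) * (F.P P.K).L ≤ θN.ν.M₁)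
    (hMrad₀ : ∀ P : B12.RunParams, (4 * (F.P P.K).d + (3 * ((F.P P.K).d * (((F.P P.K).L - 1) / 2)) + 5)) * (F.P P.K).L ^ 2 + 2 * (F.P P.K).d * (F.P P.K).L + 12 ≤ θN.ν.M₁)
    (hM₁₀ : ∀ P : B12.RunParams, (((F.P P.K).d + 4) * (F.P P.K).L + 6) * (F.P P.K).L ^ 2 ≤ θN.ν.M₁)
    -- THE GUARD ROW at the head's εreg-blind numerics `θN.ν`, per instance, along the degenerate history `(M, g) := (θN.ν.M₁, 1)` (β's `hadm`; at `A‴`: `c ≤ θN.ν.M₁`, `k P i + c₀ ≤ m + K`, `L^{c₁} ∣ θN.ν.M₁`)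
    (hadm₀ : ∀ (P : B12.RunParams) (i : ι P) (s₁ : SeqOfRecord F θN.ν θN.ν.M₁ (fun _ => (1 : ℝ)) P.K (k P i)), Adm θN.ν θN.ν.M₁ (fun _ => (1 : ℝ)) P.K (k P i) s₁)
    -- the BOX SCOPE row of the head (every `k`-bond inside `Z^{(k)}` is a bond of the region box)
    (hscope : ∀ (P : B12.RunParams) (i : ι P), {e : PBond (F.P P.K) (k P i) | e.src ∈ pts (k P i) (Z P i) ∧ e.tgt ∈ pts (k P i) (Z P i)} ⊆ boxBonds (LO P i) (HI P i))
    -- the analytic family's bound scale (`𝓐₀ P i := 4·𝓐₁`)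
    (𝓐₁ : ℝ) (h𝓐₁ : 1 < 𝓐₁)
    -- IN PLACE OF [15] THEOREM 1 (E∕U)'s NAME: THE ONE-LENGTH STEP TOKEN ᴮ at the SAME guard and the SAME constants, print's currency `(lamDatum F, dataSmall7LamTopOf F 2)`, for any ONE `C₁` with
    -- `2L³ ≤ C₁`, `8L³ < C₁B₃` ([15] Prop. 2 + Sects. B–E at ONE length given `U₀` with (14); «INHABITED BY»: OPEN — N07's obligation; the (E∕U)ᴮ name AT REGULAR-REALISED DATA follows from it
    -- and `h15` by dag-n12-c g38's `variationalThm1EUSepCoP7MGB_realised_of_step_of_reg_lamTop` ✓p782780 — SUPPLY-at-1 ∕ LIFT proved there)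
    {C₁ : ℝ} (hC₁ : 2 * (F.L : ℝ) ^ 3 ≤ C₁) (hCB : 8 * (F.L : ℝ) ^ 3 < C₁ * B₁₅)
    (hstep : VariationalThm1EUStepCoP7MGB F 2 Adm (lamDatum F) (dataSmall7LamTopOf F 2) C₁ B₁₅ a₁₅ a₁₅') :
    -- THE THREE THRESHOLDS of the (J0′) head, announced from (θN.ν, P.K, Z P i, k P i, the two [15] names) BEFORE λ ∕ the class threshold ∕ the data budget (U4-existential, instance-dependent)
    ∃ ρJ εW δ₀ : ∀ P : B12.RunParams, ι P → ℝ, (∀ P i, 0 < ρJ P i) ∧ (∀ P i, 0 < εW P i) ∧ (∀ P i, 0 < δ₀ P i) ∧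
    -- THE NINE LETTER CONSTANTS of the chart half (`C ρ Kτ ρτ ρ5`), the (P4)′ row (`εH B₁`), the small-below ∕ curvature letters (`ρ6 M₂`) — functions of `(P.K, k P)`, from the uniform producers
    ∃ C ρ Kτ ρτ ρ5 εH B₁ ρ6 M₂ : ∀ P : B12.RunParams, ι P → ℝ, (∀ P i, 0 ≤ C P i) ∧ (∀ P i, 0 < ρ P i) ∧ (∀ P i, 0 ≤ Kτ P i) ∧ (∀ P i, 0 < ρτ P i) ∧ (∀ P i, 0 < ρ5 P i) ∧
      (∀ P i, 0 < εH P i) ∧ (∀ P i, 0 ≤ B₁ P i) ∧ (∀ P i, 0 < ρ6 P i) ∧ (∀ P i, 0 ≤ M₂ P i) ∧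
    ∀ (lam : ResidW F 2), (∀ P : B12.RunParams, lam.kSel P = P.K - 1) →
      -- THE β-SIGN LEAF (T09.F; `0 ≤ bβ ≤ β` on `]0, γβ]` — NOT supplied by the engine's sign-free socket `hβc`, whose lower letter is `−β′`) at a window level `γβ ≤ min γ e⁻³` (= the bill's `γ₁₂`)
      ∀ (bβ γβ : ℝ), (0 ≤ bβ) → (0 < γβ) → (γβ ≤ γ) → (γβ ≤ Real.exp (-3)) → (BetaLowerH bβ γβ (betaOfRecord₁₃Ax F 2 θN)) →
      (∀ P : B12.RunParams, lam.kSel P < P.K → Step.InInterval γβ P.K (gOfRecord₁₃Ax F 2 θN P) → N0OfRecord₁₃Ax θN P (lam.kSel P + 1) ≤ lam.kSel P + 1 → ∀ s, LiveSeq F 2 θN.ν θN.τ9 P (gOfRecord₁₃Ax F 2 θN P) (lam.kSel P + 1)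
        (slotsTOfRecord F 2 θN.ν θN.τ9 (EOfRecord₁₃Ax F 2 θN) (wOfRecord₉ F 2 θN.toStage9Params)
          θN.ppSel P (gOfRecord₁₃Ax F 2 θN P) (lam.kSel P + 1)) s →
      0 < ∫ V, rterm (reprTOfRecord₁₃Chi F 2 θN (chiβOfRecord₁₃Ax F 2 θN) P (lam.kSel P)) s V ∂(fieldMeasure (F.P P.K) (lam.kSel P + 1) (SU 2))) →
      -- THE TERM PINS (167ᴾ ∕ 12P ✓p516715 §1) in place of the free rows at `λ.D1100 ∕ λ.D189`: data `σ sq Nm p₁ Dst`, then 12P §1's rows run by run below the torus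
      ∀ (σ : ∀ P : B12.RunParams, Sit189 F 2 P.K),
      ∀ (sq : ∀ P : B12.RunParams, SeqOfRecord F θN.ν θN.τ9.M (gOfRecord₁₃Ax F 2 θN P) P.K (lam.kSel P + 1)),
      ∀ (Nm : B12.RunParams → ℕ),
      ∀ (p₁ : ℕ),
      ∀ (Dst : ∀ P : B12.RunParams, Setting189 (F.P P.K) (SU 2) (MSField (F.P P.K) (SU 2) × ((j : ℕ) → VecField (F.P P.K) j (EuclideanSpace ℝ (Fin (2 ^ 2 - 1))))) (Pt (F.P P.K).d)),
      (∀ P : B12.RunParams, Dst P = ((ResidW.pinRPrime₁₃Ax lam θN).pinD189ΛH θN.ν θN.A₁ θN.τ9.M (gOfRecord₁₃Ax F 2 θN) (fun P => (((((σ P).pinZres θN.ν θN.τ9.M (gOfRecord₁₃Ax F 2 θN P) (sq P) (N0OfRecord₁₃Ax θN P (lam.kSel P + 1))).pinSides θN.ν (gOfRecord₁₃Ax F 2 θN P) (lam.kSel P + 1 - Nm P) (lam.kSel P + 1)).pinXΩ4 (sq P) (enlD F θN.ν θN.τ9.M P (gOfRecord₁₃Ax F 2 θN P))).pinOmegaPP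 (sq P) (Nm P) (enlD F θN.ν θN.τ9.M P (gOfRecord₁₃Ax F 2 θN P)))) sq Nm p₁).D189 P) →
      (∀ P : B12.RunParams, lam.kSel P < P.K → Step.InInterval γβ P.K (gOfRecord₁₃Ax F 2 θN P) → N0OfRecord₁₃Ax θN P (lam.kSel P + 1) ≤ lam.kSel P + 1 → N0OfRecord₁₃Ax θN P (lam.kSel P + 1) ≤ Nm P) →
      (∀ P : B12.RunParams, lam.kSel P < P.K → 0 ≤ (σ P).β) →
      (∀ P : B12.RunParams, lam.kSel P < P.K → (σ P).β ≤ 1 / 4) →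
      (∀ P : B12.RunParams, lam.kSel P < P.K → 2 ≤ (σ P).L₀) →
      (∀ P : B12.RunParams, lam.kSel P < P.K → (σ P).L₀ ^ 2 ≤ ((F.P P.K).L : ℝ)) →
      (∀ P : B12.RunParams, lam.kSel P < P.K → 0 ≤ (σ P).O1 * (σ P).B₃ * (σ P).B₅) →
      (∀ P : B12.RunParams, lam.kSel P < P.K → 0 ≤ (σ P).δ) →
      (∀ P : B12.RunParams, lam.kSel P < P.K → Step.InInterval γβ P.K (gOfRecord₁₃Ax F 2 θN P) → N0OfRecord₁₃Ax θN P (lam.kSel P + 1) ≤ lam.kSel P + 1 → (2 + (121 / 120) ^ 2 * ((σ P).O1 * (σ P).B₃ * (σ P).B₅ * (θN.τ9.M : ℝ) ^ 5)) *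
      ((((σ P).L₀ ^ 2) ^ (N0OfRecord₁₃Ax θN P (lam.kSel P + 1) - 1))⁻¹) ≤ 1 / 4) →
      (∀ P : B12.RunParams, lam.kSel P < P.K → (121 / 120) ^ 2 * ((σ P).O1 * (σ P).B₃ * (σ P).B₅ * (θN.τ9.M : ℝ) ^ 5) * Real.exp (-(4 * (σ P).δ * (θN.τ9.M : ℝ))) ≤ 1 / 12) →
      (∀ P : B12.RunParams, lam.kSel P < P.K → Step.InInterval γβ P.K (gOfRecord₁₃Ax F 2 θN P) → N0OfRecord₁₃Ax θN P (lam.kSel P + 1) ≤ lam.kSel P + 1 → (((enlD F θN.ν θN.τ9.M P (gOfRecord₁₃Ax F 2 θN P)) 4 (lam.kSel P + 1 + 1 - (N0OfRecord₁₃Ax θN P (lam.kSel P + 1)))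
        (omegaOfChain (sq P) (lam.kSel P + 1 + 1 - (N0OfRecord₁₃Ax θN P (lam.kSel P + 1)))))ᶜ ∩ (σ P).Z).Nonempty) →
      (∀ P : B12.RunParams, lam.kSel P < P.K → Step.InInterval γβ P.K (gOfRecord₁₃Ax F 2 θN P) → N0OfRecord₁₃Ax θN P (lam.kSel P + 1) ≤ lam.kSel P + 1 → ∀ U, new189 (Dst P) U → ∀ p ∈ plaqsOf (half (Dst P)),
      Ineq191 (dist1 (plaqHol ((Dst P).Upp U) p)) ((Dst P).devV'' U p) (Dst P).α (((Dst P).L ^ (Dst P).h)⁻¹) ((Dst P).ε (Dst P).h) (E124 (Dst P).ε (Dst P).L (Dst P).η (Dst P).k (Dst P).h)) →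
      (∀ P : B12.RunParams, lam.kSel P < P.K → Step.InInterval γβ P.K (gOfRecord₁₃Ax F 2 θN P) → N0OfRecord₁₃Ax θN P (lam.kSel P + 1) ≤ lam.kSel P + 1 → ∀ U, new189 (Dst P) U → ∀ p ∈ plaqsOf (half (Dst P)),
      Ineq195 ((Dst P).devV'' U p) (dist1 (plaqHol ((Dst P).Uhalf U ((Dst P).boxOf p)) p)) (Dst P).α (((Dst P).L ^ (Dst P).h)⁻¹) ((Dst P).ε (Dst P).h) (E124 (Dst P).ε (Dst P).L (Dst P).η (Dst P).k (Dst P).h)) →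
      (∀ P : B12.RunParams, lam.kSel P < P.K → Step.InInterval γβ P.K (gOfRecord₁₃Ax F 2 θN P) → N0OfRecord₁₃Ax θN P (lam.kSel P + 1) ≤ lam.kSel P + 1 → ∀ U, new189 (Dst P) U → ∀ j, (Dst P).h ≤ j → j ≤ (Dst P).k → ∀ p ∈ plaqsOf (dom (Dst P) j),
      Ineq191 (dist1 (plaqHol ((Dst P).Upp U) p)) ((Dst P).dev97 U p) (Dst P).α (((Dst P).L ^ j)⁻¹) ((Dst P).ε j) (E124 (Dst P).ε (Dst P).L (Dst P).η (Dst P).k j)) →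
      (∀ P : B12.RunParams, lam.kSel P < P.K → Step.InInterval γβ P.K (gOfRecord₁₃Ax F 2 θN P) → N0OfRecord₁₃Ax θN P (lam.kSel P + 1) ≤ lam.kSel P + 1 → ∀ U, new189 (Dst P) U → ∀ j, (Dst P).h ≤ j → j ≤ (Dst P).k → ∀ p ∈ plaqsOf (dom (Dst P) j),
      Ineq191 ((Dst P).dev97 U p) ((Dst P).dev0 U p) (Dst P).α (((Dst P).L ^ j)⁻¹) ((Dst P).ε j) (E124 (Dst P).ε (Dst P).L (Dst P).η (Dst P).k j)) →
      (∀ P : B12.RunParams, lam.kSel P < P.K → Step.InInterval γβ P.K (gOfRecord₁₃Ax F 2 θN P) → N0OfRecord₁₃Ax θN P (lam.kSel P + 1) ≤ lam.kSel P + 1 → ∀ U, new189 (Dst P) U → ∀ j, (Dst P).h ≤ j → j ≤ (Dst P).k → ∀ p ∈ plaqsOf (dom (Dst P) j),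
      Ineq180 ((Dst P).dev0 U p) ((Dst P).ε (Dst P).k) (Dst P).η (Dst P).B₃ (Dst P).B₅ (Dst P).M (Dst P).δ ((Dst P).dist p) (Dst P).O1) →
      (∀ (P : B12.RunParams) (i : ι P), ∀ (ν' : Fin (F.P P.K).d), ∀ z ∈ box (fun κ => (hi P i κ - lo P i κ + 1).toNat + 3) (fun κ => lo P i κ - 2),
      (castSite z : Site (F.P P.K) (k P i)) ∈ pts (k P i) (maxDomT θN.ν.M₁ (Z P i) (k P i)) ∧
        (castSite z : Site (F.P P.K) (k P i)).shift ⟨0, h0 P⟩ ∈ pts (k P i) (maxDomT θN.ν.M₁ (Z P i) (k P i)) ∧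
        (castSite z : Site (F.P P.K) (k P i)).shift ν' ∈ pts (k P i) (maxDomT θN.ν.M₁ (Z P i) (k P i))) →
      (∀ P : B12.RunParams, 2 * (θN.ν.εreg * (F.P P.K).L ^ 2) ≤ 2 * deltaSU (Fin 2) / ((((F.P P.K).d + 4) * (F.P P.K).L : ℕ) : ℝ) ^ 2) →
      (∀ P : B12.RunParams, (((((F.P P.K).d + 2) * (F.P P.K).L : ℕ) : ℝ) ^ 2 / 4) * (2 * (θN.ν.εreg * (F.P P.K).L ^ 2)) < deltaSU (Fin 2)) →
      (∀ (P : B12.RunParams) (i : ι P), ∀ x ∈ X P i, ∃ x₀ ∈ maxDomT θN.ν.M₁ (Z P i) (k P i), ∃ w₀ : List (Letter (F.P P.K).d), w₀.length ≤ D₀ P i ∧ walkEnd x₀ w₀ = x) →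
      (∀ (P : B12.RunParams) (i : ι P), D₀ P i + 3 * (∑ i' ∈ Finset.range (k P i + 1), ((F.P P.K).d * (((F.P P.K).L ^ i' - 1) / 2) + 1)) + ((3 * ((F.P P.K).d * (((F.P P.K).L - 1) / 2)) + 5) + 5) * (F.P P.K).L ^ k P i +
      (((F.P P.K).d + 4) * (F.P P.K).L + 2) * (∑ l ∈ Finset.Ico 0 (k P i), (F.P P.K).L ^ l) + 4 ≤ (F.P P.K).L ^ (k P i - 1) * θN.ν.M₁) →
      (∀ (P : B12.RunParams) (i : ι P) (y : Site (F.P P.K) 0), B14.Eq22Determines.blockIter (k P i) y ∈ (castSite '' Set.Icc (lo P i - 1) (hi P i + 1) : Set (Site (F.P P.K) (k P i))) → y ∈ maxDomT θN.ν.M₁ (Z P i) 1) →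
      (∀ (P : B12.RunParams) (i : ι P), 1 / 2 * (B₁₅ * (cE P + 1) * (F.P P.K).eta 1 ^ 2) ^ 2 * (Nat.card {q : Plaq (F.P P.K) 0 // q ∈ plaqsOf (maxDomT θN.ν.M₁ (Z P i) 1)} : ℝ) ≤ cA P) →
      -- the bill's [15] radius `a₁₅` sits STRICTLY above the member's regularity threshold `θN.ν.εreg = a₀` (the bill's two rows `εreg ≤ a₀`, `εreg < a₀`, here ONE letter inequality)
      (a₀ < a₁₅) →
      -- THE GUARD CAP `eG` and the cap-level datum tolerance `ρnG` with the head's rows at the cap (all upper bounds on `eG`, `ρnG`, `θN.ν.εreg`)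
      ∀ (eG ρnG : ∀ P : B12.RunParams, ι P → ℝ), (∀ (P : B12.RunParams) (i : ι P), 0 < eG P i) →
      (∀ (P : B12.RunParams) (i : ι P), 6 * ((((F.P P.K).d - 1 : ℕ)) : ℝ) * (F.P P.K).L ^ (k P i) * (2 * ((cE P + 1) * eG P i)) ≤ ρJ P i) →
      (∀ (P : B12.RunParams) (i : ι P), 12 * ((((F.P P.K).d - 1 : ℕ)) : ℝ) * (F.P P.K).L * θN.ν.εreg ≤ ρJ P i) →
      (∀ (P : B12.RunParams) (i : ι P), θN.ν.εreg ≤ εW P i) →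
      (∀ P : B12.RunParams, (143 * (((((F.P P.K).d + 4 : ℕ) : ℝ)) ^ 2 / 4) ^ 2) * (2 * ((F.P P.K).L : ℝ) ^ 2 * θN.ν.εreg) ≤ 1 / 3) →
      (∀ P : B12.RunParams, 2 * (2 * ((F.P P.K).L : ℝ) ^ 2 * θN.ν.εreg) ≤ 2 * deltaSU (Fin 2) / ((((F.P P.K).d + 4) * (F.P P.K).L : ℕ) : ℝ) ^ 2) →
      (∀ (P : B12.RunParams) (i : ι P), (cE P + 1) * (2 * eG P i) ≤ a₁₅' ∧ B₁₅ * ((cE P + 1) * (2 * eG P i)) ≤ θN.ν.εreg) →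
      (∀ (P : B12.RunParams) (i : ι P), 0 ≤ ρnG P i) →
      (∀ (P : B12.RunParams) (i : ι P), max (ρnG P i) ((((2 * (∑ i' ∈ Finset.range (k P i + 1), ((F.P P.K).d * (((F.P P.K).L ^ i' - 1) / 2) + 1)) + 1 +
                  (3 * ((F.P P.K).d * (((F.P P.K).L - 1) / 2)) + 5) * (F.P P.K).L ^ (k P i) : ℕ) : ℝ)) ^ 2 / 4 * (θN.ν.εreg * (F.P P.K).eta 0 ^ 2) +
                ((3 * ((F.P P.K).d * (((F.P P.K).L - 1) / 2)) + 5 : ℕ) : ℝ) * (6 * ((((((F.P P.K).d + 2) * (F.P P.K).L : ℕ) : ℝ) ^ 2 / 4) * (2 * (θN.ν.εreg * (F.P P.K).L ^ 2))) * ∑ i' ∈ Finset.range (k P i), ((F.P P.K).L : ℝ) ^ i') + ((3 * ((F.P P.K).d * (((F.P P.K).L - 1) / 2)) + 5 : ℕ) : ℝ) * ρnG P i) ≤ δ₀ P i) →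
      (∀ (P : B12.RunParams) (i : ι P), (((F.P P.K).d : ℝ) * n' P i + 1) * ((((F.P P.K).d - 1 : ℕ) : ℝ) * n' P i * ((12 * (F.P P.K).d * (n P i + 2) ^ 2 + 1) * eG P i) + 3 * (F.P P.K).d * (n P i + 2) ^ 2 * eG P i) ≤ ρnG P i) →
      -- THE (J0′) RADIUS, announced BEFORE the data budget `eR`
      ∃ R : ∀ P : B12.RunParams, ι P → ℝ, (∀ P i, 0 < R P i) ∧
      ∀ (eR : ∀ P : B12.RunParams, ι P → ℝ), (∀ (P : B12.RunParams) (i : ι P), 0 < eR P i) → (∀ (P : B12.RunParams) (i : ι P), eR P i ≤ eG P i) →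
      ∀ (ρn : ∀ P : B12.RunParams, ι P → ℝ),
      (∀ (P : B12.RunParams) (i : ι P), (((F.P P.K).d : ℝ) * n' P i + 1) * ((((F.P P.K).d - 1 : ℕ) : ℝ) * n' P i * ((12 * (F.P P.K).d * (n P i + 2) ^ 2 + 1) * eR P i)
      + 3 * (F.P P.K).d * (n P i + 2) ^ 2 * eR P i) ≤ ρn P i) →
      ∀ (cJ : B12.RunParams → ℝ), (∀ P : B12.RunParams, 0 ≤ cJ P) →
      (∀ (P : B12.RunParams) (i : ι P), (cE P + 1) * (2 * eR P i) ≤ a₁₅' ∧ B₁₅ * ((cE P + 1) * (2 * eR P i)) ≤ θN.ν.εreg) →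
      (∀ (P : B12.RunParams) (i : ι P), 6 * ((((F.P P.K).d - 1 : ℕ)) : ℝ) * (F.P P.K).L * (2 * B₁₅ * (cE P + 1) * eR P i) ≤ ρ5 P i) →
      (∀ (P : B12.RunParams) (i : ι P), 6 * ((((F.P P.K).d - 1 : ℕ)) : ℝ) * (F.P P.K).L * (2 * B₁₅ * (cE P + 1) * eR P i) ≤ ρ6 P i) →
      (∀ (P : B12.RunParams) (i : ι P), 2 * cA P * eR P i / R P i + 2 * ((Nat.card {q : Plaq (F.P P.K) 0 // q ∈ plaqsOf (maxDomT θN.ν.M₁ (Z P i) 1)} : ℝ) * (1 + 8 * (4 * 𝓐₁) ^ 4)) / (R P i * eR P i) ≤ cJ P) →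

    ∀ δ : ∀ P : B12.RunParams, ι P → ℝ, (∀ P i, 0 < δ P i) →
      -- the endpoint's EXPLICIT THRESHOLD per run (every quantity a displayed binder or a count of the run's instance — no `∃ δ₀`), then its TOLERANCE rows at `δ P i`
      (∀ (P : B12.RunParams) (i : ι P), δ P i ≤ min (min (min (ρ P i) (ρτ P i) / 2)
        (min 1 (1 / 2 / (2 * (3 * (Kb P i : ℝ) ^ 2 + 2 * (Kb P i : ℝ) ^ 4)) /
          (max ((32 * (((F.P P.K).d : ℝ) - 1) + 8 * (((F.P P.K).d : ℝ) - 1) + (2 * (((F.P P.K).d : ℝ) - 1) * B₁ P i * (((∑ j ∈ Finset.range (k P i + 1), (2 * (F.P P.K).d) ^ j : ℕ) : ℝ) * M₂ P i))) * (12 * (4 * 𝓐₁) / R P i * Real.sqrt (Nat.card {b : PBond (F.P P.K) 0 // b ∈ {b : PBond (F.P P.K) 0 | b.src ∈ maxDomT θN.ν.M₁ (Z P i) 1 ∨ b.tgt ∈ maxDomT θN.ν.M₁ (Z P i) 1}})) ^ 2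
            + (8 * (((F.P P.K).d : ℝ) + 1) * (2 * (Kτ P i + 1)) + 8 * ((F.P P.K).d : ℝ) * (((box (fun κ => (hi P i κ - lo P i κ + 1).toNat + 3) (fun κ => lo P i κ - 2)).image (fun z => (castSite z : Site (F.P P.K) (k P i)))).card : ℝ) * (C P i * (12 * (4 * 𝓐₁) / R P i * Real.sqrt (Nat.card {b : PBond (F.P P.K) 0 // b ∈ {b : PBond (F.P P.K) 0 | b.src ∈ maxDomT θN.ν.M₁ (Z P i) 1 ∨ b.tgt ∈ maxDomT θN.ν.M₁ (Z P i) 1}}))) ^ 2)) 0 + 1)))) (εH P i)) →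
      ∀ (hfloor : ∀ (P : B12.RunParams) (i : ι P), ((((4 * (F.P P.K).d + (3 * ((F.P P.K).d * (((F.P P.K).L - 1) / 2)) + 5) + 3 : ℕ) : ℝ)) ^ 2 * ((F.P P.K).L : ℝ) ^ 2 / 4 + ((3 * ((F.P P.K).d * (((F.P P.K).L - 1) / 2)) + 5 : ℕ) : ℝ) * (24 * (((((F.P P.K).d + 2) * (F.P P.K).L : ℕ) : ℝ) ^ 2 / 4))) * (2 * B₁₅ * (cE P + 1) * eR P i) + ((3 * ((F.P P.K).d * (((F.P P.K).L - 1) / 2)) + 5 : ℕ) : ℝ) * ρn P i ≤ δ P i),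
      ∃ (lamW : ResidW F 2) (γ₁₂ : ℝ), 0 < γ₁₂ ∧ (∀ P : B12.RunParams, 1 ≤ P.K → lamW.kSel P < P.K) ∧
        ∀ P : B12.RunParams, lamW.kSel P < P.K → Step.InInterval γ₁₂ P.K (gOfRecord₁₃Ax F 2 θN P) →
          N0OfRecord₁₃Ax θN P P.K ≤ P.K →
          B15Leaf (WOfRecord₁₃Ax F 2 θN lamW P) := by
  -- E8 at the member (its prefix letters), then the rows it displays — all but the 3 PAID below passed through
  obtain ⟨ρJ, εW, δ₀, hρJ, hεW, hδ₀, C, ρ, Kτ, ρτ, ρ5, εH, B₁, ρ6, M₂, hC, hρ, hKτ, hρτ, hρ5, hεH, hB1, hρ6, hM₂0, hmain⟩ :=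
    N24_h12F_at_theta13OfThm1CCMWZBAx_of_junctionRowsRunGuarded θN hθ hγh hB hB' ha₀ ha₁ hbox' hβ' hd3 h0 ι Z Λ k M hk0 hk1 T lo hi n hn hN hbox hZ hTG0 hN5 Kb hK1 hKn ext
      hext hlohi LO HI hLO hHI n' hn' hn'N hR' hγ hbx hbxM hM W hWbox c hkc hc X D₀ hBox hWX hfeedsX hcE0 hcE hγle hZblk hB₃ Adm h15 hAdmK hAdmTr hdiv₀ hfloor₀ hMrad₀ hM₁₀ hadm₀
      hscope 𝓐₁ h𝓐₁ hC₁ hCB hstep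
  refine ⟨ρJ, εW, δ₀, hρJ, hεW, hδ₀, C, ρ, Kτ, ρτ, ρ5, εH, B₁, ρ6, M₂, hC, hρ, hKτ, hρτ, hρ5, hεH, hB1, hρ6, hM₂0, ?_⟩
  intro lam hk bβ γβ tb hγβ0 hγβγ hγβe tlow hmassLive σ sq Nm p₁ Dst hDst tNN tβ0 tβ tL₀ tL₀L tB tδ tN₀ tMl tΛ L91h L95 L91 L97 L80 hΩw hα2 haN hXΩ
    hfit hZ1 hcA ha₁₅ eG ρnG heG hρJ1 hρJ2 hεWr hα3h hα2h haG hρnG0 hT hnormG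
  subst hθ
  -- ★ THE ROWS PAID AT THE PIN UNDER THE CEILING: `L ≥ 8`, `εreg = a₀` (`rfl` face), `d = 4`, `δ_SU(2) = 1∕3`
  have hL8 : (8 : ℝ) ≤ (F.L : ℝ) := by
    have h1 := eight_le_L_stage3OfFamily F
    have h2 := stage3OfFamily_ℓ₆_succ F
    exact_mod_cast (show (8 : ℕ) ≤ F.L by omega)
  have hL0 : (0 : ℝ) < (F.L : ℝ) := by linarith
  have ha₀L : a₀ * (F.L : ℝ) ^ 2 ≤ 1 / 109824 := by
    have h := (le_div_iff₀ (by positivity : (0 : ℝ) < 109824 * (F.L : ℝ) ^ 2)).1 ha₀ρ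
    nlinarith [h]
  -- `hα3`: `143·16²·(a₀·L²) = 36 608·(a₀L²) ≤ 1∕3` EXACTLY (`36 608 = 109 824 ∕ 3`)
  have hα3 : ∀ P : B12.RunParams, (143 * (((((F.P P.K).d + 4 : ℕ) : ℝ)) ^ 2 / 4) ^ 2) * ((theta13OfThm1CCMWZBAx F 2 j γ a₀ ε₀ ε₂₉ B₃ B₃' a₀ a₁ Efl logz).ν.εreg * (F.P P.K).L ^ 2) ≤ 1 / 3 := by
    intro P; rw [T4Family.P_d, T4Family.P_L, theta13OfThm1CCMWZBAx_εreg]; norm_num; nlinarith [ha₀L]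
  -- `hM4`: `4L ≤ 18L ≤ M₁` from the head's floor row; `hdiv` IS `hdiv₀` at the member
  have hM4 : ∀ P : B12.RunParams, 4 * (F.P P.K).L ≤ (theta13OfThm1CCMWZBAx F 2 j γ a₀ ε₀ ε₂₉ B₃ B₃' a₀ a₁ Efl logz).ν.M₁ := by
    intro P; have h18 := hfloor₀ P; rw [T4Family.P_d, T4Family.P_L] at h18; rw [T4Family.P_L]; omega
  exact hmain lam hk bβ γβ tb hγβ0 hγβγ hγβe tlow hmassLive σ sq Nm p₁ Dst hDst tNN tβ0 tβ tL₀ tL₀L tB tδ tN₀ tMl tΛ L91h L95 L91 L97 L80 hΩw hα3 hα2 haN hXΩ hfit hM4 hZ1 hdiv₀ hcA ha₁₅ eG ρnG heG hρJ1 hρJ2 hεWr hα3h hα2h haG hρnG0 hT hnormG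

end

end Summit.QuantumFields.YangMills.BalabanUVNodes.N24N12BillH12AtWitnessOfJunctionRowsRunGuardedCeilingAx

end
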